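import Summits.CriticalPhenomena.PercolationContinuityZ3.Theorems.Transplant.FKConnectivityAllQSPParSplitDefs
import HarnessLib

/-!
# Connectivity correlation inequalities for `φ_{w,q}` — file 71e: first facts about `FK.IsParSplit` (parallel first split of a special set)

Support file (`--supports stmt-CriticalPhenomena-4575`), FK sub-lane `prim-bschramm-fk-2` (gen 31) of the post-continuity
programme; builds on p205010 (kernel theorem, internal audit signed; external expert review pending).  No definitions, no named
facts, no sorries; standard axioms.  Memo FROM-fk-2-g31-DUALITY.md §4 (O).

* `FK.IsParSplit.isTTSP` — an `IsParSplit` network is a two-terminal series–parallel network (forget the orientation datum);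
* `FK.IsParSplit.two_le_card_inter` — the special set meets the network in at least two edges (one in each part of the base split);
* `FK.IsParSplit.of_inter_eq` — the predicate depends on `S` only through the trace `S ∩ E` (`FK.inter_eq_of_trace_eq`).
[cite: Grimmett2006, §3.9 (pp. 63–64)] [folklore: Duffin 1965, §4]
-/

namespace Summit.CriticalPhenomena.PercolationContinuityZ3.Theorems

namespace FK

open scoped Classical

variable {V : Type*}

/-- Forgetting the orientation: an `IsParSplit` network is a two-terminal series–parallel network. [folklore] -/
theorem IsParSplit.isTTSP {E : Finset (Sym2 V)} {a b : V} {S : Finset (Sym2 V)} (h : IsParSplit E a b S) : IsTTSP E a b := by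
  induction h with
  | base h₁ h₂ hd hV _ _ => exact IsTTSP.parallel h₁ h₂ hd hV
  | series_left _ h₂ hd hV ha hb _ ih => exact IsTTSP.series ih h₂ hd hV ha hb
  | series_right h₁ _ hd hV ha hb _ ih => exact IsTTSP.series h₁ ih hd hV ha hb
  | parallel_left _ h₂ hd hV _ ih => exact IsTTSP.parallel ih h₂ hd hV
  | parallel_right h₁ _ hd hV _ ih => exact IsTTSP.parallel h₁ ih hd hV

/-- The special set meets an `IsParSplit` network in at least two edges. [folklore] -/
theorem IsParSplit.two_le_card_inter {E : Finset (Sym2 V)} {a b : V} {S : Finset (Sym2 V)} (h : IsParSplit E a b S) :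
    2 ≤ (S ∩ E).card := by
  induction h with
  | @base E₁ E₂ s t S h₁ h₂ hd hV hS₁ hS₂ =>
    obtain ⟨e₁, he₁⟩ := hS₁
    obtain ⟨e₂, he₂⟩ := hS₂
    have hne : e₁ ≠ e₂ := fun h =>
      Finset.disjoint_left.1 hd (Finset.mem_inter.1 he₁).2 (h ▸ (Finset.mem_inter.1 he₂).2)
    calc 2 = ({e₁, e₂} : Finset (Sym2 V)).card := (Finset.card_pair hne).symm
      _ ≤ (S ∩ (E₁ ∪ E₂)).card := Finset.card_le_card (by
          rw [Finset.insert_subset_iff, Finset.singleton_subset_iff]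
          exact ⟨Finset.mem_inter.2 ⟨(Finset.mem_inter.1 he₁).1, Finset.mem_union_left _ (Finset.mem_inter.1 he₁).2⟩,
            Finset.mem_inter.2 ⟨(Finset.mem_inter.1 he₂).1, Finset.mem_union_right _ (Finset.mem_inter.1 he₂).2⟩⟩)
  | series_left _ _ _ _ _ _ _ ih =>
    exact ih.trans (Finset.card_le_card (Finset.inter_subset_inter_left Finset.subset_union_left))
  | series_right _ _ _ _ _ _ _ ih =>
    exact ih.trans (Finset.card_le_card (Finset.inter_subset_inter_left Finset.subset_union_right))
  | parallel_left _ _ _ _ _ ih =>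
    exact ih.trans (Finset.card_le_card (Finset.inter_subset_inter_left Finset.subset_union_left))
  | parallel_right _ _ _ _ _ ih =>
    exact ih.trans (Finset.card_le_card (Finset.inter_subset_inter_left Finset.subset_union_right))

/-- Traces on a part: if `S'` and `S` have the same trace on `E ⊇ A` then also on `A`. [folklore] -/
theorem inter_eq_of_trace_eq {S S' E A : Finset (Sym2 V)} (h : S' ∩ E = S ∩ E) (hA : A ⊆ E) : S' ∩ A = S ∩ A := by
  have hEA : E ∩ A = A := Finset.inter_eq_right.2 hA
  rw [← hEA, ← Finset.inter_assoc, ← Finset.inter_assoc, h]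

/-- `IsParSplit` only sees `S ∩ E`: a special set with the same trace on the network gives the same predicate. [folklore] -/
theorem IsParSplit.of_inter_eq {E : Finset (Sym2 V)} {a b : V} {S : Finset (Sym2 V)} (h : IsParSplit E a b S) :
    ∀ S' : Finset (Sym2 V), S' ∩ E = S ∩ E → IsParSplit E a b S' := by
  induction h with
  | @base E₁ E₂ s t S h₁ h₂ hd hV hS₁ hS₂ =>
    intro S' hS'
    refine IsParSplit.base h₁ h₂ hd hV ?_ ?_
    · obtain ⟨e, he⟩ := hS₁
      have : e ∈ S' ∩ (E₁ ∪ E₂) := hS' ▸ Finset.mem_inter.2 ⟨(Finset.mem_inter.1 he).1, Finset.mem_union_left _ (Finset.mem_inter.1 he).2⟩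
      exact ⟨e, Finset.mem_inter.2 ⟨(Finset.mem_inter.1 this).1, (Finset.mem_inter.1 he).2⟩⟩
    · obtain ⟨e, he⟩ := hS₂
      have : e ∈ S' ∩ (E₁ ∪ E₂) := hS' ▸ Finset.mem_inter.2 ⟨(Finset.mem_inter.1 he).1, Finset.mem_union_right _ (Finset.mem_inter.1 he).2⟩
      exact ⟨e, Finset.mem_inter.2 ⟨(Finset.mem_inter.1 this).1, (Finset.mem_inter.1 he).2⟩⟩
  | @series_left E₁ E₂ a m b S _ h₂ hd hV ha hb hS ih =>
    intro S' hS'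
    have h1 := inter_eq_of_trace_eq hS' Finset.subset_union_left
    have h2 : Disjoint S' E₂ := by
      rw [Finset.disjoint_iff_inter_eq_empty, inter_eq_of_trace_eq hS' Finset.subset_union_right]
      exact Finset.disjoint_iff_inter_eq_empty.1 hS
    exact IsParSplit.series_left (ih S' h1) h₂ hd hV ha hb h2
  | @series_right E₁ E₂ a m b S h₁ _ hd hV ha hb hS ih =>
    intro S' hS'
    have h1 := inter_eq_of_trace_eq hS' Finset.subset_union_right
    have h2 : Disjoint S' E₁ := by
      rw [Finset.disjoint_iff_inter_eq_empty, inter_eq_of_trace_eq hS' Finset.subset_union_left]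
      exact Finset.disjoint_iff_inter_eq_empty.1 hS
    exact IsParSplit.series_right h₁ (ih S' h1) hd hV ha hb h2
  | @parallel_left E₁ E₂ s t S _ h₂ hd hV hS ih =>
    intro S' hS'
    have h1 := inter_eq_of_trace_eq hS' Finset.subset_union_left
    have h2 : Disjoint S' E₂ := by
      rw [Finset.disjoint_iff_inter_eq_empty, inter_eq_of_trace_eq hS' Finset.subset_union_right]
      exact Finset.disjoint_iff_inter_eq_empty.1 hS
    exact IsParSplit.parallel_left (ih S' h1) h₂ hd hV h2
  | @parallel_right E₁ E₂ s t S h₁ _ hd hV hS ih =>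
    intro S' hS'
    have h1 := inter_eq_of_trace_eq hS' Finset.subset_union_right
    have h2 : Disjoint S' E₁ := by
      rw [Finset.disjoint_iff_inter_eq_empty, inter_eq_of_trace_eq hS' Finset.subset_union_left]
      exact Finset.disjoint_iff_inter_eq_empty.1 hS
    exact IsParSplit.parallel_right h₁ (ih S' h1) hd hV h2

end FK

end Summit.CriticalPhenomena.PercolationContinuityZ3.Theorems
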